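import Literature.Computability.AlgebraicComplexity.DetReprEquivalent
import Summits.ValiantsHypothesis.ValiantsHypothesis.Theorems.ProjectionStabilityOptStepStubGrenetProjection
import Summits.ValiantsHypothesis.ValiantsHypothesis.Theorems.ProjectionStabilityOptStepStubGrenetLeftEquivariant
import Summits.ValiantsHypothesis.ValiantsHypothesis.Theorems.ProjectionStabilityOptStepStubHalfEqTransportGauge
import Summits.ValiantsHypothesis.ValiantsHypothesis.Theorems.ProjectionStabilityOptStepStubHalfEqTransportSymm

/-!
# Crux `ProjectionStability.OptStep` (stmt-ValiantsHypothesis-17835), line `Sketch` —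
# registered stub `stub_halfEq_of_uniq` (S8): level-`n` uniqueness forces half-symmetry

**Claim settled (Landsberg–Ressayre 2017, Question 2.2, direction "unique ⇒ symmetric", in
Valiant's projection model).** Let `n ≥ 1` and suppose Grenet is optimal at level `n`
(`2ⁿ − 1 ≤ pdc(per_n)`, hence `pdc(per_n) = 2ⁿ − 1` by `stub_grenetProjection`) and optimal
projections of `per_n` are unique modulo constant gauge `GL × GL`, a realised symmetry
`γ ∈ permSymmetrySubst ℂ n` and matrix transposition (the antecedent `Uniq n` of the crux, verbatim).
Then EVERY optimal projection `D` of `per_n` is half-equivariant: `D`, or its variable-transpose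
`D.map (rename Prod.swap)`, is an exactly-lifted `leftMonomialSubst ℂ n`-equivariant affine
determinantal representation of `per_n`.

**Proof.** At the optimal size `N = 2ⁿ − 1` Grenet's matrix `G = Grenet.repr ℂ n e` (with `e`
chosen so that `G` is a strict projection, `GrenetProjection.exists_equiv_odd`,
`repr_apply_isVarOrConst`) is a competitor, so `Uniq n` gives `D = P · G(γ·x) · Q` or
`D = P · G(γ·x)ᵀ · Q`. `G` carries exact lifts of every left monomial symmetry
(`stub_grenet_leftEquivariant`); these half-lifts travel along `γ` — to `G(γ·x)` or to its
variable-transpose, according as `γ ∈ L·R` or `γ ∈ L·R·τ` (`TransportSymm.halfLifts_linSubstEntries`,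
determinant-free) — then along transposition and the constant gauge
(`forall_exists_lift_transpose`, `forall_exists_lift_mul_mul`; the variable-transpose commutes with
both, `TransportGauge.map_rename_swap_gauge/transpose`); finally `det D = per_n` (resp.
`det D(xᵀ) = per_n(xᵀ) = per_n`) and affineness of a strict projection restore
`IsEquivariantDetRepr`. The size is first made a variable (`halfEq_of_uniqAt`, any `M` with
`2ⁿ = M + 1`) and then specialised to `pdc(per_n)`.

This is the LOCAL input of the symmetry-patching line: every Laplace-restriction core of an optimal
projection of `per_{n+1}`, once identified as an optimal projection of `per_n`, inherits a conjugate
of Grenet's half-symmetry. Unconditional; no named facts; no new definitions.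
-/

-- layout Summits/ValiantsHypothesis/ValiantsHypothesis forces the duplicated namespace component
set_option linter.dupNamespace false

noncomputable section

namespace Summit.ValiantsHypothesis.ValiantsHypothesis.Theorems.ProjectionStabilityOptStep.HalfEqOfUniq

open MvPolynomial Matrix Finset
open Literature.Computability.AlgebraicComplexity

/-- A strict projection matrix (every cell a variable or a constant) has affine entries. [folklore] -/
theorem totalDegree_le_one_of_isVarOrConst {σ : Type*} {ι : Type*} {A : Matrix ι ι (MvPolynomial σ ℂ)}
    (hA : ∀ i j, (∃ v, A i j = X v) ∨ ∃ c, A i j = C c) (i j : ι) : (A i j).totalDegree ≤ 1 := by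
  rcases hA i j with ⟨v, hv⟩ | ⟨c, hc⟩
  · rw [hv, totalDegree_X]
  · rw [hc, totalDegree_C]; exact Nat.zero_le _

/-- **Uniqueness at size `M = 2ⁿ − 1` forces half-symmetry at size `M`.** If any two strict
`M × M` projections of `per_n` (`n ≥ 1`, `2ⁿ = M + 1`) are related by constant gauge, a realised
symmetry `γ ∈ permSymmetrySubst ℂ n` and possibly transposition, then every strict `M × M`
projection `D` of `per_n` is half-equivariant (compare `D` with Grenet's matrix and transport
Grenet's exact left-monomial lifts along the relation). [cite: LandsbergRessayre2017, Question 2.2] -/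
theorem halfEq_of_uniqAt {n M : ℕ} (hn : 1 ≤ n) (hM : 2 ^ n = M + 1)
    (huniq : ∀ A B : Matrix (Fin M) (Fin M) (MvPolynomial (Fin n × Fin n) ℂ),
      (∀ i j, (∃ v, A i j = X v) ∨ ∃ c, A i j = C c) →
      (∀ i j, (∃ v, B i j = X v) ∨ ∃ c, B i j = C c) →
      A.det = perPoly (Fin n) ℂ → B.det = perPoly (Fin n) ℂ →
      ∃ (P Q : GL (Fin M) ℂ) (γ : GL (Fin n × Fin n) ℂ), γ ∈ permSymmetrySubst ℂ n ∧
        (B = (P : Matrix (Fin M) (Fin M) ℂ).map C * Matrix.linSubstEntries γ A *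
              (Q : Matrix (Fin M) (Fin M) ℂ).map C ∨
          B = (P : Matrix (Fin M) (Fin M) ℂ).map C * (Matrix.linSubstEntries γ A).transpose *
              (Q : Matrix (Fin M) (Fin M) ℂ).map C))
    (D : Matrix (Fin M) (Fin M) (MvPolynomial (Fin n × Fin n) ℂ))
    (hD : ∀ i j, (∃ v, D i j = X v) ∨ ∃ c, D i j = C c) (hdet : D.det = perPoly (Fin n) ℂ) :
    IsEquivariantDetRepr (leftMonomialSubst ℂ n) (perPoly (Fin n) ℂ) D ∨
      IsEquivariantDetRepr (leftMonomialSubst ℂ n) (perPoly (Fin n) ℂ) (D.map (rename Prod.swap)) := by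
  have hn0 : n ≠ 0 := by omega
  -- Grenet's matrix as a strict projection of size `M`
  obtain ⟨e, he⟩ := GrenetProjection.exists_equiv_odd hn hM
  have hodd : Odd ((e univ : ℕ) + (e ∅ : ℕ)) := by rw [he]; exact odd_one
  have hGproj : ∀ i j, (∃ v, Grenet.repr ℂ n e i j = X v) ∨ ∃ c, Grenet.repr ℂ n e i j = C c :=
    fun i j => GrenetProjection.repr_apply_isVarOrConst ℂ e hodd i j
  have hGdet : (Grenet.repr ℂ n e).det = perPoly (Fin n) ℂ :=
    (Grenet.isAffineDetRepr_repr ℂ n hn0 hM e).2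
  have hGL := GrenetLeftEquivariant.stub_grenet_leftEquivariant n hn0 M hM e
  rw [isEquivariantDetRepr_iff_exists_mul_mul] at hGL
  -- uniqueness: `D` is a gauge/symmetry/transpose image of Grenet
  obtain ⟨P, Q, γ, hγ, hPQ⟩ := huniq (Grenet.repr ℂ n e) D hGproj hD hGdet hdet
  have hdegD : ∀ i j, (D i j).totalDegree ≤ 1 := totalDegree_le_one_of_isVarOrConst hD
  obtain ⟨τ, hτ⟩ := TransportSymm.exists_mem_transposeSubstSet (k := n)
  -- transport Grenet's half-lifts along `γ`
  rcases TransportSymm.halfLifts_linSubstEntries hτ hγ (Grenet.repr ℂ n e) (Or.inl hGL.2) with h | h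
  · -- lifts for `G(γ·x)` itself: `D` is left-equivariant
    left
    rw [isEquivariantDetRepr_iff_exists_mul_mul]
    refine ⟨⟨hdegD, hdet⟩, ?_⟩
    rcases hPQ with hB | hB <;> rw [hB]
    · exact forall_exists_lift_mul_mul h P Q
    · exact forall_exists_lift_mul_mul (forall_exists_lift_transpose h) P Q
  · -- lifts for the variable-transpose of `G(γ·x)`: `D(xᵀ)` is left-equivariant
    right
    rw [TransportSymm.linSubstEntries_of_mem_transposeSubstSet hτ] at h
    rw [isEquivariantDetRepr_iff_exists_mul_mul]
    refine ⟨⟨fun i j => ?_, ?_⟩, ?_⟩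
    · rw [Matrix.map_apply]
      exact (totalDegree_rename_le _ _).trans (hdegD i j)
    · rw [TransportGauge.det_map_rename_swap, hdet]
      exact TransportSymm.rename_swap_perPoly
    · rcases hPQ with hB | hB <;> rw [hB]
      · rw [TransportGauge.map_rename_swap_gauge]
        exact forall_exists_lift_mul_mul h P Q
      · rw [TransportGauge.map_rename_swap_gauge, TransportGauge.map_rename_swap_transpose]
        exact forall_exists_lift_mul_mul (forall_exists_lift_transpose h) P Q

/-- **S8 — level-`n` uniqueness forces half-symmetry** (registered stub `stub_halfEq_of_uniq` of line
`Sketch`, crux `ProjectionStability.OptStep`): for `n ≥ 1`, if `2ⁿ − 1 ≤ pdc(per_n)` and optimal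
projections of `per_n` are unique modulo constant gauge × `permSymmetrySubst ℂ n` × transposition
(the crux's antecedent `Uniq n`, verbatim), then every optimal projection of `per_n` is
half-equivariant. The optimal size is `2ⁿ − 1` (`stub_grenetProjection` + the hypothesis), so this
is `halfEq_of_uniqAt`. [cite: LandsbergRessayre2017, Question 2.2] -/
theorem stub_halfEq_of_uniq :
    ∀ n : ℕ, 1 ≤ n → 2 ^ n - 1 ≤ detProjectionComplexity (perPoly (Fin n) ℂ) →
      (∀ A B : Matrix (Fin (detProjectionComplexity (perPoly (Fin n) ℂ)))
          (Fin (detProjectionComplexity (perPoly (Fin n) ℂ))) (MvPolynomial (Fin n × Fin n) ℂ),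
        (∀ i j, (∃ v, A i j = MvPolynomial.X v) ∨ ∃ c, A i j = MvPolynomial.C c) →
        (∀ i j, (∃ v, B i j = MvPolynomial.X v) ∨ ∃ c, B i j = MvPolynomial.C c) →
        A.det = perPoly (Fin n) ℂ → B.det = perPoly (Fin n) ℂ →
        ∃ (P Q : GL (Fin (detProjectionComplexity (perPoly (Fin n) ℂ))) ℂ) (γ : GL (Fin n × Fin n) ℂ),
          γ ∈ permSymmetrySubst ℂ n ∧
          (B = (P : Matrix _ _ ℂ).map MvPolynomial.C * Matrix.linSubstEntries γ A * (Q : Matrix _ _ ℂ).map MvPolynomial.C ∨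
            B = (P : Matrix _ _ ℂ).map MvPolynomial.C * (Matrix.linSubstEntries γ A).transpose *
              (Q : Matrix _ _ ℂ).map MvPolynomial.C)) →
      ∀ D : Matrix (Fin (detProjectionComplexity (perPoly (Fin n) ℂ)))
          (Fin (detProjectionComplexity (perPoly (Fin n) ℂ))) (MvPolynomial (Fin n × Fin n) ℂ),
        (∀ i j, (∃ v, D i j = X v) ∨ ∃ c, D i j = C c) → D.det = perPoly (Fin n) ℂ →
        IsEquivariantDetRepr (leftMonomialSubst ℂ n) (perPoly (Fin n) ℂ) D ∨
          IsEquivariantDetRepr (leftMonomialSubst ℂ n) (perPoly (Fin n) ℂ) (D.map (rename Prod.swap)) := by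
  intro n hn hopt huniq
  obtain ⟨N, hN⟩ : ∃ N, 2 ^ n = N + 1 := ⟨2 ^ n - 1, by have := @Nat.one_le_two_pow n; omega⟩
  have hle : detProjectionComplexity (perPoly (Fin n) ℂ) ≤ 2 ^ n - 1 :=
    Nat.sInf_le (GrenetProjection.stub_grenetProjection n hn)
  have hpdc : detProjectionComplexity (perPoly (Fin n) ℂ) = N := by omega
  rw [hpdc] at huniq ⊢
  exact halfEq_of_uniqAt hn hN huniq

end Summit.ValiantsHypothesis.ValiantsHypothesis.Theorems.ProjectionStabilityOptStep.HalfEqOfUniq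

end
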